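import Summits.ValiantsHypothesis.ValiantsHypothesis.Theorems.FreeEnergyLiftMonotoneToLiftProgram

/-!
# Route `FreeEnergyLift`, item `MonotoneToLift` (stmt-ValiantsHypothesis-5606) — part 2/3:
# soundness of the cone program

At a feasible point of the cone program of part 1, by strong induction on the gate index every
nonzero gate value satisfies `V_w(e^u) ≤ e^{T_w}` (`val_V_le`: a product gate adds the
log-value forms of its operands, a sum gate gives `V_w ≤ e^{T_w}(Z₁ + Z₂) ≤ e^{T_w}`), hence
`log P(e^u) ≤ L(out) ≤ t` (`sound`). Theorem-only.
HONEST FRAMING: bookkeeping for a dormant route's dictionary item; nothing here bears on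
`VP ≠ VNP`, which is NOT proved.
-/

noncomputable section

open MvPolynomial
open scoped NNReal

-- layout Summits/ValiantsHypothesis/ValiantsHypothesis forces the duplicated namespace component
set_option linter.dupNamespace false

namespace Summit.ValiantsHypothesis.ValiantsHypothesis.Theorems.FreeEnergyLift.MonotoneLift

open Literature.Computability.AlgebraicComplexity
open Literature.Barriers.ValiantsHypothesis
open ArithCircuit

/-! ### Soundness: every feasible point bounds the free energy -/

section Sound

variable {σ : Type} [Fintype σ] (P : ArithCircuit ℝ≥0 σ)

/-- The trivial constraint is satisfied. [folklore] -/
theorem slotPt_triv_mem (p : ℕ) (v : Sp σ p) : slotPt p (triv p) v ∈ expCone := by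
  simp only [slotPt, triv, AF.ev_zero]
  exact (mem_expCone_zero 0 0).mpr ⟨le_rfl, le_rfl⟩

/-- An operand read inside gate `w` is bounded by the exponential of its log-value form, given
the bound for the earlier gates. [folklore] -/
theorem val_opVal_le (u : σ → ℝ) (t : ℝ) (y : Fin (3 * P.size) → ℝ) {w : ℕ}
    (IH : ∀ j, j < w → V P j ≠ 0 → val u (V P j) ≤ Real.exp (AF.Y y (3 * j)))
    (o : Operand ℝ≥0 σ) (ho : opVal P w o ≠ 0) :
    val u (opVal P w o) ≤ Real.exp ((LOp (3 * P.size) o).ev ((u, t), y)) := by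
  cases o with
  | var i => simp [LOp, opVal, Operand.eval]
  | const c =>
    have hc : (c : ℝ) ≠ 0 := by
      intro h
      apply ho
      simp only [opVal, Operand.eval, map_eq_zero_iff _ (C_injective σ ℝ≥0)]
      exact_mod_cast h
    have hcpos : 0 < (c : ℝ) := lt_of_le_of_ne c.2 (Ne.symm hc)
    simp [LOp, opVal, Operand.eval, Real.exp_log hcpos]
  | gate j =>
    rw [opVal_gate] at ho ⊢
    split_ifs at ho ⊢ with hj
    · simpa [LOp] using IH j hj ho
    · exact absurd rfl ho

/-- What the operand constraint of a sum gate gives. [folklore] -/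
theorem sumSlot_gives (u : σ → ℝ) (t : ℝ) (y : Fin (3 * P.size) → ℝ) {w : ℕ}
    (IH : ∀ j, j < w → V P j ≠ 0 → val u (V P j) ≤ Real.exp (AF.Y y (3 * j)))
    (args : List (ℝ≥0 × Operand ℝ≥0 σ)) (i : ℕ)
    (h : slotPt (3 * P.size) (sumSlot P (3 * P.size) w args i) ((u, t), y) ∈ expCone) :
    (∀ o, (args.map Prod.snd)[i]? = some o →
        val u (opVal P w o) ≤ Real.exp (AF.Y y (3 * w)) * AF.Y y (3 * w + 1 + i)) ∧
      0 ≤ AF.Y y (3 * w + 1 + i) := by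
  unfold sumSlot at h
  cases hoi : (args.map Prod.snd)[i]? with
  | none =>
    rw [hoi] at h
    simp only [slotPt, AF.ev_zero, AF.ev_yF, mem_expCone_zero] at h
    exact ⟨fun o ho' => by simp at ho', h.2⟩
  | some o =>
    rw [hoi] at h
    by_cases ho : opVal P w o = 0
    · simp only [ho, if_true, slotPt, AF.ev_zero, AF.ev_yF, mem_expCone_zero] at h
      refine ⟨fun o' ho' => ?_, h.2⟩
      cases ho'
      rw [ho, map_zero]
      exact mul_nonneg (Real.exp_pos _).le h.2
    · simp only [ho, if_false, slotPt, AF.ev_sub, AF.ev_yF] at h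
      rw [mem_expCone_one] at h
      have hexp : 0 < Real.exp ((LOp (3 * P.size) o).ev ((u, t), y) - AF.Y y (3 * w)) :=
        Real.exp_pos _
      refine ⟨fun o' ho' => ?_, hexp.le.trans h⟩
      cases ho'
      calc val u (opVal P w o) ≤ Real.exp ((LOp (3 * P.size) o).ev ((u, t), y)) :=
            val_opVal_le P u t y IH o ho
        _ = Real.exp (AF.Y y (3 * w)) *
              Real.exp ((LOp (3 * P.size) o).ev ((u, t), y) - AF.Y y (3 * w)) := by
            rw [← Real.exp_add]; ring_nf
        _ ≤ Real.exp (AF.Y y (3 * w)) * AF.Y y (3 * w + 1 + i) :=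
            mul_le_mul_of_nonneg_left h (Real.exp_pos _).le

/-- **Soundness of the gate constraints**: at a feasible point, every nonzero gate value is at
most the exponential of its log-variable. [folklore] -/
theorem val_V_le (hfan : P.IsFanInTwo) (hplain : IsPlain P) (u : σ → ℝ) (t : ℝ)
    (y : Fin (3 * P.size) → ℝ)
    (hsat : ∀ c, slotPt (3 * P.size) (slot P (3 * P.size) c) ((u, t), y) ∈ expCone) :
    ∀ w, w < P.size → V P w ≠ 0 → val u (V P w) ≤ Real.exp (AF.Y y (3 * w)) := by
  intro w
  induction w using Nat.strong_induction_on with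
  | _ w IH =>
  intro hw hV
  have IH' : ∀ j, j < w → V P j ≠ 0 → val u (V P j) ≤ Real.exp (AF.Y y (3 * j)) :=
    fun j hj hVj => IH j hj (hj.trans hw) hVj
  have hg : P.gates[w]? = some P.gates[w] := List.getElem?_eq_getElem hw
  have hslot : ∀ r : Fin 3, slotPt (3 * P.size) (gateSlotsOf P (3 * P.size) w (some P.gates[w]) r)
      ((u, t), y) ∈ expCone := by
    intro r
    have h := hsat ⟨3 * w + r, by omega⟩
    rw [slot_gate P (3 * P.size) hw r] at h
    unfold gateSlots at h
    rwa [if_neg hV, hg] at h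
  have hfan2 : (P.gates[w]).fanIn ≤ 2 := hfan _ (List.getElem_mem hw)
  set g := P.gates[w] with hgdef
  cases hg' : g with
  | prod os =>
    rw [hg'] at hg hslot hfan2
    have h0 := hslot 0
    simp only [gateSlotsOf, Fin.val_zero, if_true, slotPt, AF.ev_sub, AF.ev_yF, AF.ev_zero,
      mem_expCone_zero] at h0
    have hVw := V_prod P hg
    simp only [Gate.fanIn, Gate.args] at hfan2
    match os, hVw, h0, hfan2 with
    | [], hVw, h0, _ =>
      simp only [List.map_nil, List.prod_nil] at hVw
      simp only [List.map_nil, AF.ev_lsum_nil] at h0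
      rw [hVw, map_one]
      exact Real.one_le_exp (by linarith [h0.1])
    | [o], hVw, h0, _ =>
      simp only [List.map_cons, List.map_nil, List.prod_cons, List.prod_nil, mul_one] at hVw
      simp only [List.map_cons, List.map_nil, AF.ev_lsum_cons, AF.ev_lsum_nil, add_zero] at h0
      have ho : opVal P w o ≠ 0 := fun h => hV (by rw [hVw, h])
      rw [hVw]
      exact (val_opVal_le P u t y IH' o ho).trans (Real.exp_le_exp.mpr (by linarith [h0.1]))
    | [o₁, o₂], hVw, h0, _ =>
      simp only [List.map_cons, List.map_nil, List.prod_cons, List.prod_nil, mul_one] at hVw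
      simp only [List.map_cons, List.map_nil, AF.ev_lsum_cons, AF.ev_lsum_nil, add_zero] at h0
      have ho₁ : opVal P w o₁ ≠ 0 := fun h => hV (by rw [hVw, h, zero_mul])
      have ho₂ : opVal P w o₂ ≠ 0 := fun h => hV (by rw [hVw, h, mul_zero])
      rw [hVw, map_mul]
      calc val u (opVal P w o₁) * val u (opVal P w o₂)
          ≤ Real.exp ((LOp (3 * P.size) o₁).ev ((u, t), y)) *
              Real.exp ((LOp (3 * P.size) o₂).ev ((u, t), y)) :=
            mul_le_mul (val_opVal_le P u t y IH' o₁ ho₁) (val_opVal_le P u t y IH' o₂ ho₂)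
              (val_nonneg u _) (Real.exp_pos _).le
        _ ≤ Real.exp (AF.Y y (3 * w)) := by
            rw [← Real.exp_add]; exact Real.exp_le_exp.mpr (by linarith [h0.1])
    | _ :: _ :: _ :: _, _, _, hfan2 => simp at hfan2
  | sum args =>
    rw [hg'] at hg hslot hfan2
    have h0 := hslot 0
    simp only [gateSlotsOf, Fin.val_zero, if_true, slotPt, AF.ev_sub, AF.ev_add, AF.ev_yF,
      AF.ev_const, AF.ev_zero, mem_expCone_zero] at h0
    have h1 := hslot 1
    have h2 := hslot 2
    simp only [gateSlotsOf, Fin.val_one, Fin.val_two, one_ne_zero, if_false,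
      show (2 : ℕ) ≠ 0 from by norm_num] at h1 h2
    have g1 := sumSlot_gives P u t y IH' args 0 h1
    have g2 := sumSlot_gives P u t y IH' args 1 (by simpa using h2)
    have hVw := V_sum P hplain hg
    simp only [Gate.fanIn, Gate.args, List.length_map] at hfan2
    set T := Real.exp (AF.Y y (3 * w)) with hT
    have hTpos : 0 < T := Real.exp_pos _
    match args, hVw, g1, g2, hfan2 with
    | [], hVw, _, _, _ =>
      simp only [List.map_nil, List.sum_nil] at hVw
      exact absurd hVw hV
    | [a], hVw, g1, g2, _ =>
      simp only [List.map_cons, List.map_nil, List.sum_cons, List.sum_nil, add_zero] at hVw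
      have hb := g1.1 a.2 (by simp)
      rw [hVw]
      simp only [Nat.add_zero] at hb g1
      nlinarith [hb, g1.2, g2.2, h0.1, hTpos]
    | [a, b], hVw, g1, g2, _ =>
      simp only [List.map_cons, List.map_nil, List.sum_cons, List.sum_nil, add_zero] at hVw
      have hb₁ := g1.1 a.2 (by simp)
      have hb₂ := g2.1 b.2 (by simp)
      rw [hVw, map_add]
      simp only [Nat.add_zero] at hb₁ g1
      nlinarith [hb₁, hb₂, g1.2, g2.2, h0.1, hTpos]
    | _ :: _ :: _ :: _, _, _, _, hfan2 => simp at hfan2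

/-- **Soundness**: a feasible point of the cone program bounds `log P(e^u)` by `t`. [folklore] -/
theorem sound (hfan : P.IsFanInTwo) (hplain : IsPlain P) (u : σ → ℝ) (t : ℝ)
    (y : Fin (3 * P.size) → ℝ)
    (hsat : ∀ c, slotPt (3 * P.size) (slot P (3 * P.size) c) ((u, t), y) ∈ expCone) :
    Real.log (val u P.eval) ≤ t := by
  have hout := hsat ⟨3 * P.size, by omega⟩
  rw [slot_out] at hout
  unfold outSlot at hout
  by_cases h0 : P.eval = 0
  · simp only [h0, if_true, slotPt, AF.ev_sub, AF.ev_zero, AF.ev_tF, mem_expCone_zero] at hout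
    rw [h0, map_zero, Real.log_zero]
    linarith [hout.1]
  · simp only [h0, if_false, slotPt, AF.ev_sub, AF.ev_tF, AF.ev_zero, mem_expCone_zero] at hout
    have hne : opVal P P.size P.output ≠ 0 := by rwa [← eval_eq_opVal]
    have hle := val_opVal_le P u t y (w := P.size)
      (fun j hj hVj => val_V_le P hfan hplain u t y hsat j hj hVj) P.output hne
    rw [← eval_eq_opVal] at hle
    rw [Real.log_le_iff_le_exp (val_pos u h0)]
    exact hle.trans (Real.exp_le_exp.mpr (by linarith [hout.1]))

end Sound

end Summit.ValiantsHypothesis.ValiantsHypothesis.Theorems.FreeEnergyLift.MonotoneLift
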